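import Mathlib.AlgebraicGeometry.EllipticCurve.VariableChange
import Mathlib.Algebra.DualNumber
import Mathlib.Tactic.LinearCombination
import HarnessLib

/-!
# Venture HSemireg — the reparametrization action at the CUSP, to first order: LP12's matrix `d` and the free part `a₄ K[4] ⊕ a₆ K[6]` of `coker d`

Kernel form (DERIVED, elementary — Weierstrass substitution algebra) of the linear algebra printed in
[LekiliPerutz2012ArithmeticMirror2Torus] (arXiv:1211.4632v1; a PREPRINT — status words in the
literature seat's sheet `widen/LIT-W/LITW-POLISHCHUK-ORLOV-LOCATOR-SHEET.md`, rows [LP12]/[LP11]/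
[LPol19]), typed by lit-w-polishchuk-orlov (g11) as the companion of
`WeightHomogeneityVanishing.lean` (LP12 Lemma 5.3: vanishing/homogeneity) for the OTHER half of the
cell's arity-8 sentence «[μ⁸] = κ¹(a₆) ≠ 0»: in print that non-vanishing is LP12 Thm 5.5 (i)
(`[κ¹] : coker d → HH²(A,A)^{≤0}` is injective, p. 48 L6–12) TOGETHER WITH the computation of
`coker d`, eq. (20) p. 17 — and it is only the latter, purely algebraic, ingredient that is
formalised here.

SETTING AS PRINTED. [LP12, §2.2.3, p. 16 L10–46]: the reparametrization group `G ⊂ PGL(3)` of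
embedded Weierstrass curves acts «via the substitutions `x = u²x′ + r`, `y = u³y′ + u²sx′ + t`. The
effects of a substitution on the Weierstrass coefficients are listed in [16] or [54]:
`u a′₁ = a₁ + 2s` (12), `u² a′₂ = a₂ − s a₁ + 3r − s²` (13), `u³ a′₃ = a₃ + r a₁ + 2t` (14),
`u⁴ a′₄ = a₄ − s a₃ + 2r a₂ − (t + rs) a₁ + 3r² − 2st` (15),
`u⁶ a′₆ = a₆ + r a₄ + r² a₂ + r³ − t a₃ − t² − rt a₁` (16).» [p. 17 L3–21]: «The derivative of the
`G`-action on `W := Spec K[a₁, a₂, a₃, a₄, a₆]` (17) is an action of `𝔤` on `W` … `d(ξ) = ρ(ξ, 0)`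
(19) … There are `K^×`-actions on `𝔤` and on `W`, intertwined by `d`. The action on `W` is given by
`τ · a_j = τ^{−j} a_j`; that on `𝔤` by `τ·∂_s = τ^{−1}∂_s, τ·∂_r = τ^{−2}∂_r, τ·∂_t = τ^{−3}∂_t,
τ·∂_u = ∂_u`.» [p. 17 L22–63]: «taking `(∂_s, ∂_r, ∂_t, ∂_u)` as basis for `𝔤`, and
`(a₁, a₂, a₃, a₄, a₆)` as coordinates for `W`», `d` is the matrix with entries `2, 3, 2` in the
places `(a₁, ∂_s), (a₂, ∂_r), (a₃, ∂_t)` and `0` elsewhere, «and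
`W_𝔤 := coker d = a₁ K/(2)[1] ⊕ a₂ K/(3)[2] ⊕ a₃ K/(2)[3] ⊕ a₄ K[4] ⊕ a₆ K[6]` (20)».
[p. 48 L7]: first-order families are Weierstrass curves «over `K[t]/t²` with parameters
`a_i = t w_i`». REFEREED NEIGHBOUR of the slice statement:
[LekiliPolishchuk2019ModularCompactificationM1n, §1.3 eq. (1.3.1) and Thm 1.4.2, `n = 1` clause]
«`y² − x³ = δx + ε` … `deg(δ) = 4, deg(ε) = 6` … In the case `n = 1` the moduli stack `Ũ^{sns}_{1,1}`
over `Spec(ℤ[1/6])` is isomorphic to the affine space `𝔸²` with coordinates `δ, ε`».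

REUSED FROM MATHLIB (not re-proved): `WeierstrassCurve.VariableChange` (`⟨u, r, s, t⟩`), the
action `C • W` whose defining formulas `variableChange_a₁ … variableChange_a₆` ARE (12)–(16), and —
for the existence half of the `(δ, ε)` normal form when `2, 3` are invertible —
`WeierstrassCurve.exists_variableChange_isShortNF`.

WHAT IS PROVED (theorems only; `𝒞 = ⟨0,0,0,0,0⟩` is the cuspidal cubic `y² = x³`, `w = 0 ∈ W`):
* `torus_smul` — the diagonal part acts by `a_j ↦ u^{−j} a_j` (the weights of (17), p. 17 L19–20);
* `unipotent_smul_cusp` — the unipotent orbit of the cusp at finite level: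
  `⟨1, r, s, t⟩ • 𝒞 = ⟨2s, 3r − s², 2t, 3r² − 2st, r³ − t²⟩`;
* `smul_cusp_sqZero` — FIRST ORDER, over any commutative ring `S` with a square-zero parameter `e`
  (`e² = 0`; e.g. `t` in `K[t]/t²` as on p. 48 L7, or `ε` in the dual numbers —
  `smul_cusp_dualNumber`): `⟨u, r e, s e, t e⟩ • 𝒞 = ⟨u⁻¹·2s·e, u⁻²·3r·e, u⁻³·2t·e, 0, 0⟩`, i.e. the
  columns `∂_s ↦ 2a₁, ∂_r ↦ 3a₂, ∂_t ↦ 2a₃` of LP12's matrix `d` and `∂_u ↦ 0` at `w = 0`;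
  in particular `firstOrder_a₄_eq_zero` ∕ `firstOrder_a₆_eq_zero`: the weight-`4` and weight-`6`
  coordinates are untouched to first order — the free summands `a₄ K[4] ⊕ a₆ K[6]` of (20) — while
  `firstOrder_a₁ ∕ _a₂ ∕ _a₃` exhibit the image `2S·e, 3S·e, 2S·e` (the torsion summands of (20));
* `unipotent_slice` — FINITE-LEVEL form of the same splitting: if `2` and `3` are
  non-zero-divisors in `R`, a unipotent substitution that keeps a curve of the slice
  `{a₁ = a₂ = a₃ = 0}` (a point `(a₄, a₆)` of `W₄ ⊕ W₆`) inside the slice is the identity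
  (`r = s = t = 0`), so `(a₄, a₆)` is unchanged (`unipotent_smul_slice_eq_self`): the plane
  `(a₄, a₆) = (δ, ε)` meets each unipotent orbit at most once.

NOT PROVED HERE (and not claimed): anything about `A∞`-structures, Hochschild cohomology, `κ¹`,
or the non-vanishing `[μ⁸] ≠ 0` itself (LP12 Thm 5.5 (i) ∕ [LekiliPerutz2011FukayaTorusDehnSurgery,
Prop 9]); no moduli stack is constructed. HONEST FRAMING: substitution algebra on five
coefficients only; nothing here says that HC, HC_CM or HC_AV holds, and nothing here is a new case
of anything.
-/

namespace Summit.Ventures.HSemireg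

namespace CuspReparametrization

open WeierstrassCurve

variable {R : Type*} [CommRing R]

/-! ### The diagonal part: weights `τ · a_j = τ^{-j} a_j` -/

/-- **Weights.** The substitution `x = u² x′, y = u³ y′` multiplies `a_j` by `u^{−j}`
(LP12 (17), p. 17 L19–20; formulas (12)–(16) with `r = s = t = 0`). [DERIVED from Mathlib's
`variableChange_aⱼ`] -/
theorem torus_smul (u : Rˣ) (W : WeierstrassCurve R) :
    (⟨u, 0, 0, 0⟩ : VariableChange R) • W =
      ⟨(↑u⁻¹ : R) * W.a₁, (↑u⁻¹ : R) ^ 2 * W.a₂, (↑u⁻¹ : R) ^ 3 * W.a₃, (↑u⁻¹ : R) ^ 4 * W.a₄,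
        (↑u⁻¹ : R) ^ 6 * W.a₆⟩ := by
  ext <;> simp only [variableChange_a₁, variableChange_a₂, variableChange_a₃, variableChange_a₄,
    variableChange_a₆] <;> ring

/-! ### The unipotent orbit of the cusp, at finite level -/

/-- **The unipotent orbit of the cusp.** Applying `x = x′ + r, y = y′ + s x′ + t` to the cuspidal
cubic `y² = x³` (all `a_j = 0`) gives the Weierstrass coefficients
`(2s, 3r − s², 2t, 3r² − 2st, r³ − t²)` ((12)–(16) at `a = 0, u = 1`). [DERIVED] -/
theorem unipotent_smul_cusp (r s t : R) :
    (⟨1, r, s, t⟩ : VariableChange R) • (⟨0, 0, 0, 0, 0⟩ : WeierstrassCurve R) =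
      ⟨2 * s, 3 * r - s ^ 2, 2 * t, 3 * r ^ 2 - 2 * s * t, r ^ 3 - t ^ 2⟩ := by
  ext <;> simp only [variableChange_a₁, variableChange_a₂, variableChange_a₃, variableChange_a₄,
    variableChange_a₆, inv_one, Units.val_one] <;> ring

/-! ### First order: a square-zero parameter (LP12's matrix `d`, eq. (20)) -/

section SqZero

variable {S : Type*} [CommRing S]

/-- **LP12's matrix `d` at the cusp.** Over a commutative ring `S` with a square-zero parameter `e`
(`e * e = 0`: `t` in `K[t]/t²`, p. 48 L7), the substitution with `(r, s, t) = (r₀ e, s₀ e, t₀ e)`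
and any unit `u` sends the cusp to `(u⁻¹·2s₀ e, u⁻²·3r₀ e, u⁻³·2t₀ e, 0, 0)`: the columns
`∂_s ↦ 2a₁, ∂_r ↦ 3a₂, ∂_t ↦ 2a₃, ∂_u ↦ 0` of `d` (p. 17 L22–46). [DERIVED] -/
theorem smul_cusp_sqZero (e : S) (he : e * e = 0) (u : Sˣ) (r s t : S) :
    (⟨u, r * e, s * e, t * e⟩ : VariableChange S) • (⟨0, 0, 0, 0, 0⟩ : WeierstrassCurve S) =
      ⟨(↑u⁻¹ : S) * (2 * s * e), (↑u⁻¹ : S) ^ 2 * (3 * r * e), (↑u⁻¹ : S) ^ 3 * (2 * t * e),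
        0, 0⟩ := by
  ext <;> simp only [variableChange_a₁, variableChange_a₂, variableChange_a₃, variableChange_a₄,
    variableChange_a₆]
  · ring
  · linear_combination (-((↑u⁻¹ : S) ^ 2 * s ^ 2)) * he
  · ring
  · linear_combination ((↑u⁻¹ : S) ^ 4 * (3 * r ^ 2 - 2 * s * t)) * he
  · linear_combination ((↑u⁻¹ : S) ^ 6 * (r ^ 3 * e - t ^ 2)) * he

/-- The unipotent case `u = 1` of `smul_cusp_sqZero`: `⟨1, r e, s e, t e⟩ • 𝒞 = ⟨2s e, 3r e, 2t e, 0, 0⟩`.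
[DERIVED] -/
theorem unipotent_smul_cusp_sqZero (e : S) (he : e * e = 0) (r s t : S) :
    (⟨1, r * e, s * e, t * e⟩ : VariableChange S) • (⟨0, 0, 0, 0, 0⟩ : WeierstrassCurve S) =
      ⟨2 * s * e, 3 * r * e, 2 * t * e, 0, 0⟩ := by
  rw [smul_cusp_sqZero e he 1 r s t]
  simp

/-- **Weight 4 is first-order rigid** (the free summand `a₄ K[4]` of `coker d`, eq. (20)): the
`a₄`-coordinate of a first-order reparametrization of the cusp vanishes. [DERIVED] -/
theorem firstOrder_a₄_eq_zero (e : S) (he : e * e = 0) (u : Sˣ) (r s t : S) :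
    ((⟨u, r * e, s * e, t * e⟩ : VariableChange S) • (⟨0, 0, 0, 0, 0⟩ : WeierstrassCurve S)).a₄
      = 0 := by
  rw [smul_cusp_sqZero e he u r s t]

/-- **Weight 6 is first-order rigid** (the free summand `a₆ K[6]` of `coker d`, eq. (20)): the
`a₆`-coordinate of a first-order reparametrization of the cusp vanishes — the direction `a₆`
(the `E_ω`-line `y² = x³ + a₆`, arity `8 = 6 + 2`) is not a first-order gauge direction. [DERIVED] -/
theorem firstOrder_a₆_eq_zero (e : S) (he : e * e = 0) (u : Sˣ) (r s t : S) :
    ((⟨u, r * e, s * e, t * e⟩ : VariableChange S) • (⟨0, 0, 0, 0, 0⟩ : WeierstrassCurve S)).a₆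
      = 0 := by
  rw [smul_cusp_sqZero e he u r s t]

/-- The torsion summands of (20): to first order the unipotent substitutions reach exactly
`a₁ = 2s e`, `a₂ = 3r e`, `a₃ = 2t e` (so `coker` has `K/(2), K/(3), K/(2)` in weights `1, 2, 3`).
[DERIVED] -/
theorem firstOrder_a₁_a₂_a₃ (e : S) (he : e * e = 0) (r s t : S) :
    ((⟨1, r * e, s * e, t * e⟩ : VariableChange S) • (⟨0, 0, 0, 0, 0⟩ : WeierstrassCurve S)).a₁
        = 2 * s * e ∧
      ((⟨1, r * e, s * e, t * e⟩ : VariableChange S) • (⟨0, 0, 0, 0, 0⟩ : WeierstrassCurve S)).a₂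
        = 3 * r * e ∧
      ((⟨1, r * e, s * e, t * e⟩ : VariableChange S) • (⟨0, 0, 0, 0, 0⟩ : WeierstrassCurve S)).a₃
        = 2 * t * e := by
  rw [unipotent_smul_cusp_sqZero e he r s t]
  exact ⟨rfl, rfl, rfl⟩

end SqZero

/-! ### The dual numbers as the square-zero ring -/

section Dual

open DualNumber TrivSqZeroExt

/-- `smul_cusp_sqZero` over the dual numbers `R[ε]` (`ε² = 0`), unipotent case:
`⟨1, r ε, s ε, t ε⟩ • 𝒞 = ⟨2s ε, 3r ε, 2t ε, 0, 0⟩`. [DERIVED] -/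
theorem smul_cusp_dualNumber (r s t : R[ε]) :
    (⟨1, r * ε, s * ε, t * ε⟩ : VariableChange R[ε]) • (⟨0, 0, 0, 0, 0⟩ : WeierstrassCurve R[ε]) =
      ⟨2 * s * ε, 3 * r * ε, 2 * t * ε, 0, 0⟩ :=
  unipotent_smul_cusp_sqZero ε eps_mul_eps r s t

end Dual

/-! ### Finite level: the plane `{a₁ = a₂ = a₃ = 0}` is a slice for the unipotent action -/

/-- **Slice.** If `2` and `3` are non-zero-divisors in `R` and a unipotent substitution
`⟨1, r, s, t⟩` maps a curve with `a₁ = a₂ = a₃ = 0` (a point `(a₄, a₆)` of `W₄ ⊕ W₆`) to a curve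
with `a₁ = a₂ = a₃ = 0`, then `r = s = t = 0` ((12)–(14): `2s = 0`, `3r − s² = 0`, `2t = 0`).
[DERIVED] -/
theorem unipotent_slice (h2 : ∀ x : R, 2 * x = 0 → x = 0) (h3 : ∀ x : R, 3 * x = 0 → x = 0)
    (a₄ a₆ r s t : R)
    (h₁ : ((⟨1, r, s, t⟩ : VariableChange R) • (⟨0, 0, 0, a₄, a₆⟩ : WeierstrassCurve R)).a₁ = 0)
    (h₂ : ((⟨1, r, s, t⟩ : VariableChange R) • (⟨0, 0, 0, a₄, a₆⟩ : WeierstrassCurve R)).a₂ = 0)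
    (h₃ : ((⟨1, r, s, t⟩ : VariableChange R) • (⟨0, 0, 0, a₄, a₆⟩ : WeierstrassCurve R)).a₃ = 0) :
    r = 0 ∧ s = 0 ∧ t = 0 := by
  simp only [variableChange_a₁, variableChange_a₂, variableChange_a₃, inv_one, Units.val_one,
    one_pow, one_mul, mul_zero, add_zero, zero_add, sub_zero] at h₁ h₂ h₃
  have hs : s = 0 := h2 s h₁
  subst hs
  have hr : r = 0 := h3 r (by linear_combination h₂)
  have ht : t = 0 := h2 t h₃
  exact ⟨hr, rfl, ht⟩

/-- **The slice coordinates are invariants.** Under the hypotheses of `unipotent_slice` the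
substitution is the identity, so the curve — in particular `(a₄, a₆) = (δ, ε)` — is unchanged.
[DERIVED] -/
theorem unipotent_smul_slice_eq_self (h2 : ∀ x : R, 2 * x = 0 → x = 0)
    (h3 : ∀ x : R, 3 * x = 0 → x = 0) (a₄ a₆ r s t : R)
    (h₁ : ((⟨1, r, s, t⟩ : VariableChange R) • (⟨0, 0, 0, a₄, a₆⟩ : WeierstrassCurve R)).a₁ = 0)
    (h₂ : ((⟨1, r, s, t⟩ : VariableChange R) • (⟨0, 0, 0, a₄, a₆⟩ : WeierstrassCurve R)).a₂ = 0)
    (h₃ : ((⟨1, r, s, t⟩ : VariableChange R) • (⟨0, 0, 0, a₄, a₆⟩ : WeierstrassCurve R)).a₃ = 0) :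
    (⟨1, r, s, t⟩ : VariableChange R) • (⟨0, 0, 0, a₄, a₆⟩ : WeierstrassCurve R) =
      ⟨0, 0, 0, a₄, a₆⟩ := by
  obtain ⟨rfl, rfl, rfl⟩ := unipotent_slice h2 h3 a₄ a₆ r s t h₁ h₂ h₃
  ext <;> simp [variableChange_a₁, variableChange_a₂, variableChange_a₃, variableChange_a₄,
    variableChange_a₆]

/-- NON-VACUITY of the slice hypotheses: without them the conclusion fails — in characteristic `2`
(`2 = 0` in `R`) the substitution `⟨1, 0, 1, 0⟩` (`s = 1`) keeps `a₁ = a₃ = 0` and moves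
`a₂` by `−1`, and more to the point `⟨1, 0, s, 0⟩ • ⟨0,0,0,a₄,a₆⟩` has `a₁ = 2s`, which is `0`
for every `s` when `2 = 0`. Here: the general formula for that substitution. [DERIVED] -/
theorem shear_smul_slice (a₄ a₆ s : R) :
    (⟨1, 0, s, 0⟩ : VariableChange R) • (⟨0, 0, 0, a₄, a₆⟩ : WeierstrassCurve R) =
      ⟨2 * s, -s ^ 2, 0, a₄, a₆⟩ := by
  ext <;> simp only [variableChange_a₁, variableChange_a₂, variableChange_a₃, variableChange_a₄,
    variableChange_a₆, inv_one, Units.val_one] <;> ring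

end CuspReparametrization

end Summit.Ventures.HSemireg
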